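import Summits.AtomisticToContinuum.Crystallization.Theorems.ExcessDecayLiouvilleLatticeParam
import Summits.AtomisticToContinuum.Crystallization.Theorems.ExcessDecayLiouvilleCaccioppoliLocalWeights
import Summits.AtomisticToContinuum.Crystallization.Theorems.ExcessDecayLiouvilleDiscreteSobolev1D
import Summits.AtomisticToContinuum.Crystallization.Theorems.ExcessDecayLiouvillePathSums

/-!
# Route `ExcessDecayLiouville`: affine fields on the site set — basic tools

Campanato bookkeeping for the excess-decay argument of item `ExcessDecay` (stmt-AtomisticToContinuum-9334),
harmonic-replacement architecture.  An AFFINE FIELD on the sites of an admissible datum is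
`aff (t m + A z) = a m + B (t m + A z − c₀)` (two sublattice translations `a 0, a 1`, ONE linear part `B`,
centre `c₀`).  Its local `ℓ²`-mass on a ball, `Σ'_p ‖aff p‖² · 𝟙[dist p c₀ ≤ ρ]`, controls its coefficients:

* `eq_coord_smul_add`, `abs_coords_le` : coordinates of a vector in the lattice basis `u₁, u₂, w₃`;
* `opNorm_le_of_lattice_images` : `‖B‖ ≤ (200/189)(2‖B(Au₁)‖ + 2‖B(Au₂)‖ + ‖B(Aw₃)‖)`;
* `summable_normSq_indicator`, `sum_le_localMass` : a finite injective family of sites of the ball has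
  `Σ ‖f‖² ≤` the local mass;
* `latticeBox_injective`, `norm_latticeBox_le`, `card_latticeBox` : the coordinate box `|i|,|j|,|k| ≤ n`;
* `norm_generators_le` : lattice bookkeeping (`nsmul_mem_Λ₀` is in `ExcessDecayLiouvillePathSums.lean`).

The norm equivalence itself is `affine_coeff_sq_le_localMass` in `ExcessDecayLiouvilleAffineFields.lean`.

All `[folklore]`; helper lemmas, nothing here closes an item.
-/

noncomputable section

namespace Summit.AtomisticToContinuum.Crystallization.Theorems.ExcessDecayLiouville

open scoped BigOperators Topology InnerProductSpace RealInnerProductSpace Classical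
open Literature.MathematicalPhysics.StatisticalMechanics
open Summit.AtomisticToContinuum.Crystallization.Theorems.PhononStabilityNegative
open Summit.AtomisticToContinuum.Crystallization.Theorems

-- the three lattice generators and the lattice vector with integer coordinates (notations, not definitions)
local notation "𝐮₁" => (triangularVec₁ 1 : EuclideanSpace ℝ (Fin 3))
local notation "𝐮₂" => (triangularVec₂ 1 : EuclideanSpace ℝ (Fin 3))
local notation "𝐰₃" => (layerNormal (2 * Real.sqrt (2 / 3)) : EuclideanSpace ℝ (Fin 3))
local notation "𝐳[" i ", " j ", " k "]" =>
  (((i : ℤ) : ℝ) • (triangularVec₁ 1 : EuclideanSpace ℝ (Fin 3)) + ((j : ℤ) : ℝ) • triangularVec₂ 1 +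
    ((k : ℤ) : ℝ) • layerNormal (2 * Real.sqrt (2 / 3)))

/-! ## Coordinates in the lattice basis and the operator norm of a linear part -/

/-- Every vector decomposes in the basis `u₁ = (1,0,0)`, `u₂ = (1/2, √3/2, 0)`, `w₃ = (0,0,2√(2/3))`. [folklore] -/
theorem eq_coord_smul_add (y : EuclideanSpace ℝ (Fin 3)) :
    y = (y 0 - y 1 / Real.sqrt 3) • 𝐮₁ + (2 * y 1 / Real.sqrt 3) • 𝐮₂ + (y 2 / (2 * Real.sqrt (2 / 3))) • 𝐰₃ := by
  have h3 : Real.sqrt 3 ≠ 0 := by positivity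
  have h23 : Real.sqrt (2 / 3) ≠ 0 := by positivity
  ext i
  fin_cases i
  · simp [triangularVec₁, triangularVec₂, layerNormal]
    field_simp
    ring
  · simp [triangularVec₁, triangularVec₂, layerNormal]
    field_simp
  · simp [triangularVec₁, triangularVec₂, layerNormal]

/-- Coordinate bounds: `|y₀ − y₁/√3| ≤ 2‖y‖`, `|2y₁/√3| ≤ 2‖y‖`, `|y₂/(2√(2/3))| ≤ ‖y‖`. [folklore] -/
theorem abs_coords_le (y : EuclideanSpace ℝ (Fin 3)) :
    |y 0 - y 1 / Real.sqrt 3| ≤ 2 * ‖y‖ ∧ |2 * y 1 / Real.sqrt 3| ≤ 2 * ‖y‖ ∧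
      |y 2 / (2 * Real.sqrt (2 / 3))| ≤ ‖y‖ := by
  have h0 : |y 0| ≤ ‖y‖ := by simpa using PiLp.norm_apply_le y 0
  have h1 : |y 1| ≤ ‖y‖ := by simpa using PiLp.norm_apply_le y 1
  have h2 : |y 2| ≤ ‖y‖ := by simpa using PiLp.norm_apply_le y 2
  have hs3 : (1 : ℝ) ≤ Real.sqrt 3 := by
    rw [Real.one_le_sqrt]; norm_num
  have hs23 : (4 / 5 : ℝ) ≤ Real.sqrt (2 / 3) := by
    rw [Real.le_sqrt (by norm_num) (by norm_num)]; norm_num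
  have hs3pos : (0 : ℝ) < Real.sqrt 3 := by positivity
  have hs23pos : (0 : ℝ) < Real.sqrt (2 / 3) := by positivity
  refine ⟨?_, ?_, ?_⟩
  · have : |y 1 / Real.sqrt 3| ≤ ‖y‖ := by
      rw [abs_div, abs_of_pos hs3pos, div_le_iff₀ hs3pos]
      nlinarith [norm_nonneg y]
    calc |y 0 - y 1 / Real.sqrt 3| ≤ |y 0| + |y 1 / Real.sqrt 3| := abs_sub _ _
      _ ≤ 2 * ‖y‖ := by linarith
  · rw [abs_div, abs_of_pos hs3pos, div_le_iff₀ hs3pos, abs_mul, abs_two]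
    nlinarith [norm_nonneg y, abs_nonneg (y 1)]
  · have hpos : (0 : ℝ) < 2 * Real.sqrt (2 / 3) := by positivity
    rw [abs_div, abs_of_pos hpos, div_le_iff₀ hpos]
    nlinarith [norm_nonneg y]

/-- **Operator norm of a linear part from its values on the lattice generators**: for an admissible
cell, `‖B‖ ≤ (200/189)(2‖B(Au₁)‖ + 2‖B(Au₂)‖ + ‖B(Aw₃)‖)`. [folklore] -/
theorem opNorm_le_of_lattice_images {A : (EuclideanSpace ℝ (Fin 3)) →L[ℝ] (EuclideanSpace ℝ (Fin 3))} (hA : Adm₀ A)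
    (B : (EuclideanSpace ℝ (Fin 3)) →L[ℝ] (EuclideanSpace ℝ (Fin 3))) :
    ‖B‖ ≤ 200 / 189 * (2 * ‖B (A 𝐮₁)‖ + 2 * ‖B (A 𝐮₂)‖ + ‖B (A 𝐰₃)‖) := by
  refine ContinuousLinearMap.opNorm_le_bound _ (by positivity) fun x => ?_
  obtain ⟨y, rfl⟩ := surjective_of_adm₀ hA x
  have hy : ‖y‖ ≤ 200 / 189 * ‖A y‖ := by
    have := hcpLiouvilleAdm_norm_le hA y
    linarith
  obtain ⟨c1, c2, c3⟩ := abs_coords_le y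
  have hdec := eq_coord_smul_add y
  have hBy : B (A y) = (y 0 - y 1 / Real.sqrt 3) • B (A 𝐮₁) + (2 * y 1 / Real.sqrt 3) • B (A 𝐮₂) +
      (y 2 / (2 * Real.sqrt (2 / 3))) • B (A 𝐰₃) := by
    conv_lhs => rw [hdec]
    simp only [map_add, map_smul]
  rw [hBy]
  have e1 : ‖(y 0 - y 1 / Real.sqrt 3) • B (A 𝐮₁)‖ ≤ 2 * ‖y‖ * ‖B (A 𝐮₁)‖ := by
    rw [norm_smul, Real.norm_eq_abs]; gcongr
  have e2 : ‖(2 * y 1 / Real.sqrt 3) • B (A 𝐮₂)‖ ≤ 2 * ‖y‖ * ‖B (A 𝐮₂)‖ := by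
    rw [norm_smul, Real.norm_eq_abs]; gcongr
  have e3 : ‖(y 2 / (2 * Real.sqrt (2 / 3))) • B (A 𝐰₃)‖ ≤ ‖y‖ * ‖B (A 𝐰₃)‖ := by
    rw [norm_smul, Real.norm_eq_abs]; gcongr
  have hn1 := norm_nonneg (B (A 𝐮₁))
  have hn2 := norm_nonneg (B (A 𝐮₂))
  have hn3 := norm_nonneg (B (A 𝐰₃))
  calc ‖(y 0 - y 1 / Real.sqrt 3) • B (A 𝐮₁) + (2 * y 1 / Real.sqrt 3) • B (A 𝐮₂) +
        (y 2 / (2 * Real.sqrt (2 / 3))) • B (A 𝐰₃)‖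
      ≤ ‖(y 0 - y 1 / Real.sqrt 3) • B (A 𝐮₁)‖ + ‖(2 * y 1 / Real.sqrt 3) • B (A 𝐮₂)‖ +
          ‖(y 2 / (2 * Real.sqrt (2 / 3))) • B (A 𝐰₃)‖ := norm_add₃_le
    _ ≤ 2 * ‖y‖ * ‖B (A 𝐮₁)‖ + 2 * ‖y‖ * ‖B (A 𝐮₂)‖ + ‖y‖ * ‖B (A 𝐰₃)‖ := by linarith
    _ = ‖y‖ * (2 * ‖B (A 𝐮₁)‖ + 2 * ‖B (A 𝐮₂)‖ + ‖B (A 𝐰₃)‖) := by ring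
    _ ≤ (200 / 189 * ‖A y‖) * (2 * ‖B (A 𝐮₁)‖ + 2 * ‖B (A 𝐮₂)‖ + ‖B (A 𝐰₃)‖) := by
        gcongr
    _ = 200 / 189 * (2 * ‖B (A 𝐮₁)‖ + 2 * ‖B (A 𝐮₂)‖ + ‖B (A 𝐰₃)‖) * ‖A y‖ := by ring

/-! ## Local `ℓ²`-mass and finite sub-families -/

section

variable {t : Fin 2 → (EuclideanSpace ℝ (Fin 3))} {A : (EuclideanSpace ℝ (Fin 3)) →L[ℝ] (EuclideanSpace ℝ (Fin 3))}

/-- The local `ℓ²`-mass family `p ↦ ‖f p‖² 𝟙[dist p c₀ ≤ ρ]` is finitely supported, hence summable. [folklore] -/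
theorem summable_normSq_indicator (hA : Adm₀ A) (hI : Inner₀ t A) (f : (EuclideanSpace ℝ (Fin 3)) → (EuclideanSpace ℝ (Fin 3)))
    (c₀ : EuclideanSpace ℝ (Fin 3)) (ρ : ℝ) :
    Summable (fun p : Sites₀ t A => ‖f p‖ ^ 2 * (if dist (p : EuclideanSpace ℝ (Fin 3)) c₀ ≤ ρ then (1 : ℝ) else 0)) := by
  have hfin := finite_sites_dist_le hA hI c₀ ρ
  have hfin' : Set.Finite {p : Sites₀ t A | dist (p : EuclideanSpace ℝ (Fin 3)) c₀ ≤ ρ} :=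
    (hfin.preimage Subtype.val_injective.injOn).subset fun p hp => ⟨p.2, hp⟩
  refine summable_of_ne_finset_zero (s := hfin'.toFinset) fun p hp => ?_
  have : ¬ dist (p : EuclideanSpace ℝ (Fin 3)) c₀ ≤ ρ := fun h => hp ((Set.Finite.mem_toFinset _).2 h)
  rw [if_neg this, mul_zero]

/-- **A finite injective family of sites of the ball is dominated by the local mass.** [folklore] -/
theorem sum_le_localMass (hA : Adm₀ A) (hI : Inner₀ t A) (f : (EuclideanSpace ℝ (Fin 3)) → (EuclideanSpace ℝ (Fin 3)))
    (c₀ : EuclideanSpace ℝ (Fin 3)) (ρ : ℝ) {ι : Type*} (I : Finset ι) (φ : ι → EuclideanSpace ℝ (Fin 3))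
    (hφS : ∀ i ∈ I, φ i ∈ Sites₀ t A) (hφd : ∀ i ∈ I, dist (φ i) c₀ ≤ ρ) (hinj : Set.InjOn φ I) :
    ∑ i ∈ I, ‖f (φ i)‖ ^ 2 ≤
      ∑' p : Sites₀ t A, ‖f p‖ ^ 2 * (if dist (p : EuclideanSpace ℝ (Fin 3)) c₀ ≤ ρ then (1 : ℝ) else 0) := by
  classical
  -- the family as a Finset of sites
  set ψ : I → Sites₀ t A := fun i => ⟨φ i, hφS i i.2⟩ with hψ
  have hψinj : Function.Injective ψ := by
    intro i j h
    have : φ i = φ j := congrArg Subtype.val h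
    exact Subtype.ext (hinj i.2 j.2 this)
  set s : Finset (Sites₀ t A) := Finset.univ.image ψ with hs
  have hsum : ∑ p ∈ s, ‖f p‖ ^ 2 * (if dist (p : EuclideanSpace ℝ (Fin 3)) c₀ ≤ ρ then (1 : ℝ) else 0) =
      ∑ i ∈ I, ‖f (φ i)‖ ^ 2 := by
    rw [hs, Finset.sum_image (fun i _ j _ h => hψinj h)]
    rw [← Finset.sum_coe_sort I]
    refine Finset.sum_congr rfl fun i _ => ?_
    rw [hψ]
    simp only [if_pos (hφd i i.2), mul_one]
  rw [← hsum]
  exact (summable_normSq_indicator hA hI f c₀ ρ).sum_le_tsum s (fun p _ => by positivity)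

end

/-! ## The coordinate box -/

/-- The lattice vector with coordinates `(i,j,k)` determines its coordinates. [folklore] -/
theorem latticeBox_injective : Function.Injective (fun ijk : ℤ × ℤ × ℤ => 𝐳[ijk.1, ijk.2.1, ijk.2.2]) := by
  rintro ⟨i, j, k⟩ ⟨i', j', k'⟩ h
  obtain ⟨h1, h2, h3⟩ := latticeCoords_eq h
  simp only at h1 h2 h3
  rw [h1, h2, h3]

/-- In the box `|i|,|j|,|k| ≤ n` the lattice vector has norm `≤ 4n`. [folklore] -/
theorem norm_latticeBox_le {n : ℕ} {i j k : ℤ} (hi : |i| ≤ n) (hj : |j| ≤ n) (hk : |k| ≤ n) :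
    ‖𝐳[i, j, k]‖ ≤ 4 * n := by
  have h := norm_latticeVec_le i j k
  have hi' : |(i : ℝ)| ≤ n := by exact_mod_cast hi
  have hj' : |(j : ℝ)| ≤ n := by exact_mod_cast hj
  have hk' : |(k : ℝ)| ≤ n := by exact_mod_cast hk
  linarith

/-- Membership in the box finset `Icc (−n) n ³`. [folklore] -/
theorem mem_box_iff {n : ℕ} {ijk : ℤ × ℤ × ℤ} :
    ijk ∈ (Finset.Icc (-(n : ℤ)) n) ×ˢ (Finset.Icc (-(n : ℤ)) n) ×ˢ (Finset.Icc (-(n : ℤ)) n) ↔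
      |ijk.1| ≤ n ∧ |ijk.2.1| ≤ n ∧ |ijk.2.2| ≤ n := by
  simp only [Finset.mem_product, Finset.mem_Icc, abs_le]

/-- The box has `(2n+1)³` elements. [folklore] -/
theorem card_latticeBox (n : ℕ) :
    ((Finset.Icc (-(n : ℤ)) n) ×ˢ (Finset.Icc (-(n : ℤ)) n) ×ˢ (Finset.Icc (-(n : ℤ)) n)).card = (2 * n + 1) ^ 3 := by
  have h1 : (Finset.Icc (-(n : ℤ)) n).card = 2 * n + 1 := by
    rw [Int.card_Icc]; omega
  rw [Finset.card_product, Finset.card_product, h1]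
  ring

/-- The generators have norm `≤ 2`: `‖u₁‖ = ‖u₂‖ = 1`, `‖w₃‖² = 8/3`. [folklore] -/
theorem norm_generators_le : ‖𝐮₁‖ ≤ 2 ∧ ‖𝐮₂‖ ≤ 2 ∧ ‖𝐰₃‖ ≤ 2 := by
  have h1 := hcpLiouvilleLam_norm_sq 1 0 0
  have h2 := hcpLiouvilleLam_norm_sq 0 1 0
  have h3 := hcpLiouvilleLam_norm_sq 0 0 1
  simp only [Int.cast_one, one_smul, Int.cast_zero, zero_smul, add_zero, zero_add] at h1 h2 h3
  have e1 : ‖𝐮₁‖ ^ 2 = 1 := by rw [h1]; norm_num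
  have e2 : ‖𝐮₂‖ ^ 2 = 1 := by rw [h2]; norm_num
  have e3 : ‖𝐰₃‖ ^ 2 = 8 / 3 := by rw [h3]; norm_num
  refine ⟨?_, ?_, ?_⟩
  · nlinarith [norm_nonneg 𝐮₁]
  · nlinarith [norm_nonneg 𝐮₂]
  · nlinarith [norm_nonneg 𝐰₃]

end Summit.AtomisticToContinuum.Crystallization.Theorems.ExcessDecayLiouville

end
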